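import Literature.AlgebraicGeometry.Motives.HermitianUnitaryFrame
import HarnessLib

/-!
# The Hermitian space of a Weil datum: `(V_ℝ, i = √-d ⊗ 1/√d, H = E(·, i·) + iE)` has signature `(n, n)`

Van Geemen (LNM 1594, 5.3–5.5) and Deligne (LNM 900, proof of Thm. 4.8, pp. 47–49): the Weil
family is built from a datum `(V, K = ℚ(√-d), E)` — a `ℚ`-vector space `V` with an action of
`√-d` (`α`, `α² = -d`, `d > 0`) and a non-degenerate alternating form `E` with
`E(αx, αy) = d·E(x, y)` (the Riemann form of a polarization of Weil type, van Geemen 4.9). On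
`V_ℝ := V ⊗_ℚ ℝ` "multiplication by `i := √-d ⊗ (1/√d)` defines a structure of complex vector space
`(V_ℝ, i)`" (5.5), and "one recovers (the `ℝ`-linear extension of) `H` as
`H(x, y) = E(x, iy) + iE(x, y)`" (5.6; Lemma 5.2 (2): "a non-degenerate Hermitian form …
`K`-linear in the second factor"). Deligne's domain `X` is the set of `ℝ`-linear `J : V_ℝ → V_ℝ`,
`J² = -1`, with (a') `J` is `K`-linear and (b') `ψ(x, Jy)` symmetric (`⟺ ψ(Jx, Jy) = ψ(x, y)`)
and definite; `X⁺ ⊂ X` is where it is positive definite (p. 49).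

This file formalizes exactly this bridge from the tree's `ℚ`-vocabulary
(`Motives/WeilHermitianWitt`, `Motives/WeilDiscriminant`: `α`, `E`, `d`) to the Hermitian-space
vocabulary of `Motives/WeilTypeComplexStructures` … `Motives/HermitianUnitaryFrame`:

* `WeilDatum V`: the datum `(d > 0, α, E)` with `α² = -d`, `E` alternating non-degenerate,
  `E(αx, αy) = d E(x, y)`;
* `D.Cx`: the complex vector space `(V_ℝ, i)` (a type synonym of `ℝ ⊗[ℚ] V` with `Module ℂ` given by
  `(a + bi)·x = a x + b I₀ x`, `I₀ = (√d)⁻¹ α_ℝ`), `2 · dim_ℂ D.Cx = dim_ℚ V` (`two_mul_finrank_Cx`);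
* `D.hForm : D.Cx →ₗ⋆[ℂ] D.Cx →ₗ[ℂ] ℂ`, `H(x, y) = E(x, I₀y) + iE(x, y)`: Hermitian (`isSymm_hForm`),
  non-degenerate (`separatingLeft_hForm`), with `Im H = E_ℝ` (`hForm_apply_im`), so that
  `IsWeilComplexStructure D.hForm J` for a `ℂ`-linear (= `K ⊗ ℝ`-linear) `J` is literally Deligne's
  `X⁺` (`isWeilComplexStructure_iff`);
* the SIGNATURE: if `dim_ℚ V = 4n` and `V` contains an `α`-stable `E`-isotropic `ℚ`-subspace of
  dimension `2n` (the hyperbolic case of the tree's `IsHyperbolicWeilType`; for a datum coming from a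
  polarized abelian variety of Weil type this is van Geemen 5.2 (4)), then every unitary frame of
  `(D.Cx, H)` has signature `(n, n)` (`UnitaryFrame.signature_eq_of_isotropic`) and such frames exist
  (`nonempty_unitaryFrame_of_isotropic`), whence
  `X⁺ ≃ unitaryPeriodDomain n n = {Z : ℂⁿ →L ℂⁿ, ‖Z‖ < 1} ≅ SU(n, n)/S(U(n) × U(n))`
  (`nonempty_weilComplexStructureEquiv_of_isotropic`; van Geemen 5.10, Deligne p. 49 "open connected").

Everything is proved; no named fact is introduced.

## References

* [vanGeemen1994HodgeAV] B. van Geemen, *An introduction to the Hodge conjecture for abelian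
  varieties*, LNM 1594 (1994), Lemma 5.2, 5.3–5.6, 5.8–5.10.
* [Deligne1982HodgeCycles] P. Deligne, *Hodge cycles on abelian varieties*, LNM 900 (1982), proof
  of Thm. 4.8, pp. 47–49.
* [GohbergLancasterRodman2005] I. Gohberg, P. Lancaster, L. Rodman, *Indefinite Linear Algebra and
  Applications* (2005), §2.3 Thm. 2.3.2 (inertia).
-/

noncomputable section

open Module
open scoped TensorProduct ComplexConjugate

namespace Literature.AlgebraicGeometry.Motives

universe u

/-- A **Weil datum** on a `ℚ`-vector space `V` (van Geemen 5.3, Deligne p. 47): a positive rational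
`d`, the action `α` of `√-d ∈ K = ℚ(√-d)` (`α² = -d`), and a non-degenerate alternating form `E`
with `E(αx, αy) = d·E(x, y)` ("`(√-d)^* E = dE`", van Geemen 4.9: the Riemann form of a
polarization of Weil type). [cite: vanGeemen1994HodgeAV, 5.3 and 4.9] -/
structure WeilDatum (V : Type u) [AddCommGroup V] [Module ℚ V] where
  /-- The positive rational `d` with `K = ℚ(√-d)`. -/
  d : ℚ
  /-- `d > 0`. -/
  d_pos : 0 < d
  /-- The action of `√-d` on `V`. -/
  α : V →ₗ[ℚ] V
  /-- The alternating form (Riemann form of the polarization). -/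
  E : LinearMap.BilinForm ℚ V
  /-- `α² = -d`. -/
  α_α : ∀ x, α (α x) = -(d • x)
  /-- `E` is alternating (skew-symmetric). -/
  E_swap : ∀ x y, E y x = -E x y
  /-- `E(αx, αy) = d E(x, y)`. -/
  E_α : ∀ x y, E (α x) (α y) = d * E x y
  /-- `E` is non-degenerate. -/
  E_nondegenerate : E.Nondegenerate

/-- **Inertia, lower half**: a non-positive subspace (`Re H(x, x) ≤ 0` on it, e.g. a totally
isotropic one) has dimension `≤ dim V⁻` — it meets `V⁺` trivially. The mirror image of
`SignatureSplitting.finrank_le_of_nonneg`. [cite: GohbergLancasterRodman2005, §2.3 Thm. 2.3.2] -/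
theorem SignatureSplitting.finrank_le_of_nonpos {V' : Type*} [AddCommGroup V'] [Module ℂ V']
    [FiniteDimensional ℂ V'] {H : V' →ₗ⋆[ℂ] V' →ₗ[ℂ] ℂ} (σ : SignatureSplitting H)
    {L : Submodule ℂ V'} (hL : ∀ x ∈ L, (H x x).re ≤ 0) : finrank ℂ L ≤ finrank ℂ σ.neg := by
  have hdisj : Disjoint L σ.pos := by
    rw [Submodule.disjoint_def]
    intro x hxL hxP
    by_contra hne
    exact absurd (σ.isPosDefOn_pos x hxP hne) (not_lt.2 (hL x hxL))
  have h := Submodule.finrank_sup_add_finrank_inf_eq L σ.pos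
  rw [hdisj.eq_bot, finrank_bot, add_zero] at h
  have h1 : finrank ℂ ↥(L ⊔ σ.pos) ≤ finrank ℂ V' := Submodule.finrank_le _
  have h2 := σ.finrank_pos_add_finrank_neg
  omega

namespace WeilDatum

variable {V : Type u} [AddCommGroup V] [Module ℚ V] (D : WeilDatum V)

/-- The Weil datum in the tree's `K`-module vocabulary (`Motives/WeilHermitianWitt.exists_linearEquiv_weil_of_isotropic_rat`,
`Motives/WeilDiscriminant.weilHermitianForm`): `V` a `K`-vector space, `α ∈ K` with `α² = -d`,
acting by scalar multiplication. [cite: vanGeemen1994HodgeAV, 5.3] -/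
def ofSMul {K : Type*} [Field K] [Algebra ℚ K] [Module K V] [IsScalarTower ℚ K V]
    (E : LinearMap.BilinForm ℚ V) {α : K} {d : ℚ} (hd : 0 < d) (hα : α * α = algebraMap ℚ K (-d))
    (hE : ∀ x y, E y x = -E x y) (hW : ∀ x y, E (α • x) (α • y) = d * E x y)
    (hN : E.Nondegenerate) : WeilDatum V where
  d := d
  d_pos := hd
  α := (LinearMap.lsmul K V α).restrictScalars ℚ
  E := E
  α_α x := by
    show α • α • x = -(d • x)
    rw [smul_smul, hα, algebraMap_smul, neg_smul]
  E_swap := hE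
  E_α := hW
  E_nondegenerate := hN

/-- The action in `ofSMul` is scalar multiplication by `α`. [cite: vanGeemen1994HodgeAV, 5.3] -/
@[simp]
theorem ofSMul_α_apply {K : Type*} [Field K] [Algebra ℚ K] [Module K V] [IsScalarTower ℚ K V]
    (E : LinearMap.BilinForm ℚ V) {α : K} {d : ℚ} (hd : 0 < d) (hα : α * α = algebraMap ℚ K (-d))
    (hE : ∀ x y, E y x = -E x y) (hW : ∀ x y, E (α • x) (α • y) = d * E x y)
    (hN : E.Nondegenerate) (x : V) : (ofSMul E hd hα hE hW hN).α x = α • x := rfl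

/-! ### Realification `V_ℝ = ℝ ⊗_ℚ V`, `α_ℝ`, `E_ℝ` -/

/-- `d ≠ 0`. [cite: vanGeemen1994HodgeAV, 5.3] -/
theorem d_ne_zero : D.d ≠ 0 := D.d_pos.ne'

/-- `E(αx, y) = -E(x, αy)` (`α` is skew-adjoint for `E`). [cite: vanGeemen1994HodgeAV, proof of Lemma 5.2] -/
theorem E_α_left (x y : V) : D.E (D.α x) y = -D.E x (D.α y) := by
  have h := D.E_α x (D.α y)
  rw [D.α_α, map_neg, map_smul, smul_eq_mul] at h
  have hd := D.d_ne_zero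
  have : D.d * D.E (D.α x) y = D.d * (-D.E x (D.α y)) := by linarith
  exact mul_left_cancel₀ hd this

/-- `α_ℝ = 1 ⊗ α` on `V_ℝ = ℝ ⊗_ℚ V`. [cite: vanGeemen1994HodgeAV, 5.5] -/
def αℝ : ℝ ⊗[ℚ] V →ₗ[ℝ] ℝ ⊗[ℚ] V := D.α.baseChange ℝ

/-- `E_ℝ`, the `ℝ`-bilinear extension of `E` to `V_ℝ`. [cite: vanGeemen1994HodgeAV, 5.5] -/
def Eℝ : LinearMap.BilinForm ℝ (ℝ ⊗[ℚ] V) := D.E.baseChange ℝ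

/-- `α_ℝ (a ⊗ v) = a ⊗ α v`. [folklore] -/
@[simp]
theorem αℝ_tmul (a : ℝ) (v : V) : D.αℝ (a ⊗ₜ v) = a ⊗ₜ D.α v :=
  LinearMap.baseChange_tmul _ _ _

/-- `E_ℝ (a ⊗ v, a' ⊗ v') = a a' E(v, v')`. [folklore] -/
@[simp]
theorem Eℝ_tmul (a : ℝ) (v : V) (a' : ℝ) (v' : V) :
    D.Eℝ (a ⊗ₜ v) (a' ⊗ₜ v') = a * a' * (D.E v v' : ℝ) := by
  rw [Eℝ, LinearMap.BilinForm.baseChange_tmul, Rat.smul_def, mul_comm]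

/-- `α_ℝ² = -d`. [cite: vanGeemen1994HodgeAV, 5.5] -/
theorem αℝ_αℝ (x : ℝ ⊗[ℚ] V) : D.αℝ (D.αℝ x) = -((D.d : ℝ) • x) := by
  induction x using TensorProduct.induction_on with
  | zero => simp
  | tmul a v =>
    rw [αℝ_tmul, αℝ_tmul, D.α_α, TensorProduct.tmul_neg, TensorProduct.tmul_smul,
      ← algebraMap_smul ℝ D.d (a ⊗ₜ[ℚ] v), eq_ratCast]
  | add x y hx hy => rw [map_add, map_add, hx, hy, smul_add, neg_add]

/-- `E_ℝ` is alternating. [cite: vanGeemen1994HodgeAV, 5.5] -/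
theorem Eℝ_swap (x y : ℝ ⊗[ℚ] V) : D.Eℝ y x = -D.Eℝ x y := by
  induction x using TensorProduct.induction_on generalizing y with
  | zero => simp
  | tmul a v =>
    induction y using TensorProduct.induction_on with
    | zero => simp
    | tmul a' v' => rw [Eℝ_tmul, Eℝ_tmul, D.E_swap]; push_cast; ring
    | add y₁ y₂ h₁ h₂ => rw [map_add, LinearMap.add_apply, map_add, h₁, h₂, neg_add]
  | add x₁ x₂ h₁ h₂ => rw [map_add, map_add, LinearMap.add_apply, h₁, h₂, neg_add]

/-- `E_ℝ(x, x) = 0`. [cite: vanGeemen1994HodgeAV, 5.5] -/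
theorem Eℝ_self (x : ℝ ⊗[ℚ] V) : D.Eℝ x x = 0 := by
  have h := D.Eℝ_swap x x
  linarith

/-- `E_ℝ(α_ℝ x, α_ℝ y) = d E_ℝ(x, y)`. [cite: vanGeemen1994HodgeAV, 4.9 and 5.5] -/
theorem Eℝ_αℝ (x y : ℝ ⊗[ℚ] V) : D.Eℝ (D.αℝ x) (D.αℝ y) = D.d * D.Eℝ x y := by
  induction x using TensorProduct.induction_on generalizing y with
  | zero => simp
  | tmul a v =>
    induction y using TensorProduct.induction_on with
    | zero => simp
    | tmul a' v' => rw [αℝ_tmul, αℝ_tmul, Eℝ_tmul, Eℝ_tmul, D.E_α]; push_cast; ring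
    | add y₁ y₂ h₁ h₂ => rw [map_add, map_add, map_add, h₁, h₂, mul_add]
  | add x₁ x₂ h₁ h₂ =>
    rw [map_add, map_add, LinearMap.add_apply, map_add, LinearMap.add_apply, h₁, h₂, mul_add]

/-- `E_ℝ(α_ℝ x, y) = -E_ℝ(x, α_ℝ y)`. [cite: vanGeemen1994HodgeAV, proof of Lemma 5.2] -/
theorem Eℝ_αℝ_left (x y : ℝ ⊗[ℚ] V) : D.Eℝ (D.αℝ x) y = -D.Eℝ x (D.αℝ y) := by
  have h := D.Eℝ_αℝ x (D.αℝ y)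
  rw [D.αℝ_αℝ, map_neg, map_smul, smul_eq_mul] at h
  have hd : (D.d : ℝ) ≠ 0 := by exact_mod_cast D.d_ne_zero
  have : (D.d : ℝ) * D.Eℝ (D.αℝ x) y = D.d * (-D.Eℝ x (D.αℝ y)) := by linarith
  exact mul_left_cancel₀ hd this

/-- `E_ℝ` is non-degenerate (the Gram determinant of `E` in a `ℚ`-basis is that of `E_ℝ` in the
base-changed basis). [folklore] -/
theorem Eℝ_nondegenerate [FiniteDimensional ℚ V] : D.Eℝ.Nondegenerate := by
  classical
  let b := Module.finBasis ℚ V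
  let b' : Basis _ ℝ (ℝ ⊗[ℚ] V) := Algebra.TensorProduct.basis ℝ b
  rw [LinearMap.BilinForm.nondegenerate_iff_det_ne_zero b']
  have h : LinearMap.BilinForm.toMatrix b' D.Eℝ =
      (algebraMap ℚ ℝ).mapMatrix (LinearMap.BilinForm.toMatrix b D.E) := by
    ext i j
    rw [LinearMap.BilinForm.toMatrix_apply, RingHom.mapMatrix_apply, Matrix.map_apply,
      LinearMap.BilinForm.toMatrix_apply, Algebra.TensorProduct.basis_apply,
      Algebra.TensorProduct.basis_apply, Eℝ_tmul, one_mul, one_mul, eq_ratCast]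
  rw [h, ← RingHom.map_det, map_ne_zero_iff _ (algebraMap ℚ ℝ).injective]
  exact (LinearMap.BilinForm.nondegenerate_iff_det_ne_zero b).1 D.E_nondegenerate

/-! ### The complex structure `I₀ = √-d ⊗ 1/√d` -/

/-- The normalising constant `c = 1/√d`. [cite: vanGeemen1994HodgeAV, 5.5] -/
def c : ℝ := (Real.sqrt D.d)⁻¹

/-- `c² d = 1`. [cite: vanGeemen1994HodgeAV, 5.5] -/
theorem c_mul_c_mul_d : D.c * D.c * D.d = 1 := by
  have hd : (0 : ℝ) < D.d := by exact_mod_cast D.d_pos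
  rw [c, ← mul_inv, Real.mul_self_sqrt hd.le, inv_mul_cancel₀ hd.ne']

/-- **van Geemen's `i := √-d ⊗ (1/√d)`** on `V_ℝ`. [cite: vanGeemen1994HodgeAV, 5.5] -/
def I₀ : ℝ ⊗[ℚ] V →ₗ[ℝ] ℝ ⊗[ℚ] V := D.c • D.αℝ

/-- `I₀ x = c · α_ℝ x`. [cite: vanGeemen1994HodgeAV, 5.5] -/
theorem I₀_apply (x : ℝ ⊗[ℚ] V) : D.I₀ x = D.c • D.αℝ x := rfl

/-- `I₀² = -1`. [cite: vanGeemen1994HodgeAV, 5.5] -/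
theorem I₀_I₀ (x : ℝ ⊗[ℚ] V) : D.I₀ (D.I₀ x) = -x := by
  rw [I₀_apply, I₀_apply, map_smul, αℝ_αℝ, smul_neg, smul_neg, smul_smul, smul_smul, c_mul_c_mul_d,
    one_smul]

/-- `I₀ * I₀ = -1` in `End_ℝ(V_ℝ)`. [cite: vanGeemen1994HodgeAV, 5.5] -/
theorem I₀_mul_I₀ : D.I₀ * D.I₀ = -1 := by
  ext x
  simp [I₀_I₀]

/-- `E_ℝ(I₀ x, I₀ y) = E_ℝ(x, y)`. [cite: vanGeemen1994HodgeAV, 5.5–5.6] -/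
theorem Eℝ_I₀ (x y : ℝ ⊗[ℚ] V) : D.Eℝ (D.I₀ x) (D.I₀ y) = D.Eℝ x y := by
  rw [I₀_apply, I₀_apply, map_smul, map_smul, LinearMap.smul_apply, Eℝ_αℝ, smul_eq_mul, smul_eq_mul,
    ← mul_assoc, ← mul_assoc, c_mul_c_mul_d, one_mul]

/-- `E_ℝ(I₀ x, y) = -E_ℝ(x, I₀ y)`. [cite: vanGeemen1994HodgeAV, 5.5–5.6] -/
theorem Eℝ_I₀_left (x y : ℝ ⊗[ℚ] V) : D.Eℝ (D.I₀ x) y = -D.Eℝ x (D.I₀ y) := by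
  rw [I₀_apply, I₀_apply, map_smul, map_smul, LinearMap.smul_apply, Eℝ_αℝ_left, smul_eq_mul,
    smul_eq_mul, mul_neg]

/-- `E_ℝ(x, I₀ x)` is symmetric in the sense `E_ℝ(x, I₀ y) = E_ℝ(y, I₀ x)`. [cite: vanGeemen1994HodgeAV, 5.6] -/
theorem Eℝ_I₀_symm (x y : ℝ ⊗[ℚ] V) : D.Eℝ x (D.I₀ y) = D.Eℝ y (D.I₀ x) := by
  rw [D.Eℝ_swap (D.I₀ x) y, Eℝ_I₀_left, neg_neg]

/-! ### The complex vector space `(V_ℝ, i)` -/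

/-- **The complex vector space `(V_ℝ, i)`** of the Weil datum (van Geemen 5.5): the real vector
space `V_ℝ = ℝ ⊗_ℚ V` with `(a + bi)·x := a x + b I₀ x`. A type synonym of `ℝ ⊗[ℚ] V` carrying
this `Module ℂ` instance (the real structure is then `Module.complexToReal`, which agrees with
the tensor one: `toCx_smul`). [cite: vanGeemen1994HodgeAV, 5.5] -/
def Cx (_D : WeilDatum V) : Type u := ℝ ⊗[ℚ] V

/-- The additive group of `(V_ℝ, i)` is that of `V_ℝ`. [cite: vanGeemen1994HodgeAV, 5.5] -/
instance instAddCommGroupCx : AddCommGroup D.Cx := inferInstanceAs (AddCommGroup (ℝ ⊗[ℚ] V))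

/-- The `ℝ`-algebra map `ℂ → End_ℝ(V_ℝ)`, `a + bi ↦ a + b I₀` (`Complex.lift` at `I₀² = -1`).
[cite: vanGeemen1994HodgeAV, 5.5] -/
def liftEnd : ℂ →ₐ[ℝ] Module.End ℝ (ℝ ⊗[ℚ] V) := Complex.lift ⟨D.I₀, D.I₀_mul_I₀⟩

/-- `liftEnd z = re z + im z · I₀`. [cite: vanGeemen1994HodgeAV, 5.5] -/
theorem liftEnd_apply_apply (z : ℂ) (x : ℝ ⊗[ℚ] V) : D.liftEnd z x = z.re • x + z.im • D.I₀ x := by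
  rw [liftEnd, Complex.lift_apply, Complex.liftAux_apply, LinearMap.add_apply, LinearMap.smul_apply,
    Module.algebraMap_end_apply]

/-- **The complex structure `(V_ℝ, i)`**: `ℂ` acts through `a + bi ↦ a + b I₀`. [cite: vanGeemen1994HodgeAV, 5.5] -/
instance instModuleComplex : Module ℂ D.Cx :=
  Module.compHom (ℝ ⊗[ℚ] V) (D.liftEnd : ℂ →+* Module.End ℝ (ℝ ⊗[ℚ] V))

/-- The identification `V_ℝ = (V_ℝ, i)` (identity on the underlying additive group).
[cite: vanGeemen1994HodgeAV, 5.5] -/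
def toCx : ℝ ⊗[ℚ] V ≃+ D.Cx := AddEquiv.refl _

/-- The inverse identification. [cite: vanGeemen1994HodgeAV, 5.5] -/
def ofCx : D.Cx ≃+ ℝ ⊗[ℚ] V := AddEquiv.refl _

/-- `ofCx ∘ toCx = id`. [folklore] -/
@[simp] theorem ofCx_toCx (x : ℝ ⊗[ℚ] V) : D.ofCx (D.toCx x) = x := rfl

/-- `toCx ∘ ofCx = id`. [folklore] -/
@[simp] theorem toCx_ofCx (x : D.Cx) : D.toCx (D.ofCx x) = x := rfl

/-- The complex scalar action: `z · x = re z · x + im z · I₀ x`. [cite: vanGeemen1994HodgeAV, 5.5] -/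
theorem ofCx_smul (z : ℂ) (x : D.Cx) : D.ofCx (z • x) = z.re • D.ofCx x + z.im • D.I₀ (D.ofCx x) :=
  D.liftEnd_apply_apply z x

/-- `z · toCx x = toCx (re z · x + im z · I₀ x)`. [cite: vanGeemen1994HodgeAV, 5.5] -/
theorem smul_toCx (z : ℂ) (x : ℝ ⊗[ℚ] V) : z • D.toCx x = D.toCx (z.re • x + z.im • D.I₀ x) :=
  D.liftEnd_apply_apply z x

/-- Real scalars act as before: `(r : ℂ) · toCx x = toCx (r x)`. [cite: vanGeemen1994HodgeAV, 5.5] -/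
theorem coe_smul_toCx (r : ℝ) (x : ℝ ⊗[ℚ] V) : (r : ℂ) • D.toCx x = D.toCx (r • x) := by
  rw [smul_toCx]; simp

/-- `Module.complexToReal` on `(V_ℝ, i)` is the original real structure. [cite: vanGeemen1994HodgeAV, 5.5] -/
theorem toCx_smul (r : ℝ) (x : ℝ ⊗[ℚ] V) : D.toCx (r • x) = r • D.toCx x := by
  rw [← Complex.coe_smul, coe_smul_toCx]

/-- `i · toCx x = toCx (I₀ x)`: the complex unit acts by van Geemen's `i`. [cite: vanGeemen1994HodgeAV, 5.5] -/
theorem I_smul_toCx (x : ℝ ⊗[ℚ] V) : Complex.I • D.toCx x = D.toCx (D.I₀ x) := by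
  rw [smul_toCx]; simp

/-- `ofCx (i · x) = I₀ (ofCx x)`. [cite: vanGeemen1994HodgeAV, 5.5] -/
theorem ofCx_I_smul (x : D.Cx) : D.ofCx (Complex.I • x) = D.I₀ (D.ofCx x) := by
  rw [ofCx_smul]; simp

/-- `ofCx ((r : ℂ) · x) = r · ofCx x`. [cite: vanGeemen1994HodgeAV, 5.5] -/
theorem ofCx_coe_smul (r : ℝ) (x : D.Cx) : D.ofCx ((r : ℂ) • x) = r • D.ofCx x := by
  rw [ofCx_smul]; simp

/-- The identification `V_ℝ ≃ (V_ℝ, i)` is `ℝ`-linear (for `Module.complexToReal`). [cite: vanGeemen1994HodgeAV, 5.5] -/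
def toCxₗ : (ℝ ⊗[ℚ] V) ≃ₗ[ℝ] D.Cx :=
  { D.toCx with map_smul' := fun r x => D.toCx_smul r x }

/-- `toCxₗ = toCx` on elements. [folklore] -/
@[simp] theorem toCxₗ_apply (x : ℝ ⊗[ℚ] V) : D.toCxₗ x = D.toCx x := rfl

/-- `toCxₗ⁻¹ = ofCx` on elements. [folklore] -/
@[simp] theorem toCxₗ_symm_apply (x : D.Cx) : D.toCxₗ.symm x = D.ofCx x := rfl

/-- `(V_ℝ, i)` is finite-dimensional over `ℝ` when `V` is over `ℚ`. [folklore] -/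
instance instFiniteReal [FiniteDimensional ℚ V] : Module.Finite ℝ D.Cx :=
  Module.Finite.equiv D.toCxₗ

/-- `(V_ℝ, i)` is finite-dimensional over `ℂ` when `V` is over `ℚ`. [folklore] -/
instance instFiniteComplex [FiniteDimensional ℚ V] : FiniteDimensional ℂ D.Cx :=
  Module.Finite.of_restrictScalars_finite ℝ ℂ D.Cx

/-- `dim_ℝ (V_ℝ, i) = dim_ℚ V`. [cite: vanGeemen1994HodgeAV, 5.5] -/
theorem finrank_real_Cx : finrank ℝ D.Cx = finrank ℚ V := by
  rw [← D.toCxₗ.finrank_eq, Module.finrank_baseChange]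

/-- **`2 dim_ℂ (V_ℝ, i) = dim_ℚ V`** ("`V_ℝ ≅ ℂ^{2n}`" for `dim_K V = 2n`). [cite: vanGeemen1994HodgeAV, 5.5] -/
theorem two_mul_finrank_Cx : 2 * finrank ℂ D.Cx = finrank ℚ V := by
  rw [← finrank_real_of_complex, finrank_real_Cx]

/-! ### Van Geemen's Hermitian form `H(x, y) = E(x, iy) + iE(x, y)` -/

/-- The auxiliary function `(x, y) ↦ E_ℝ(x, I₀y) + iE_ℝ(x, y)` on `V_ℝ`. [cite: vanGeemen1994HodgeAV, 5.6 and Lemma 5.2 (2)] -/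
def hAux (x y : ℝ ⊗[ℚ] V) : ℂ := ⟨D.Eℝ x (D.I₀ y), D.Eℝ x y⟩

/-- `Re (E_ℝ(x, I₀y) + iE_ℝ(x, y)) = E_ℝ(x, I₀y)`. [cite: vanGeemen1994HodgeAV, 5.6] -/
@[simp] theorem hAux_re (x y : ℝ ⊗[ℚ] V) : (D.hAux x y).re = D.Eℝ x (D.I₀ y) := rfl

/-- `Im (E_ℝ(x, I₀y) + iE_ℝ(x, y)) = E_ℝ(x, y)`. [cite: vanGeemen1994HodgeAV, 5.6] -/
@[simp] theorem hAux_im (x y : ℝ ⊗[ℚ] V) : (D.hAux x y).im = D.Eℝ x y := rfl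

/-- Additivity in the first variable. [cite: vanGeemen1994HodgeAV, Lemma 5.2 (2)] -/
theorem hAux_add_left (x₁ x₂ y : ℝ ⊗[ℚ] V) : D.hAux (x₁ + x₂) y = D.hAux x₁ y + D.hAux x₂ y := by
  apply Complex.ext <;> simp

/-- Additivity in the second variable. [cite: vanGeemen1994HodgeAV, Lemma 5.2 (2)] -/
theorem hAux_add_right (x y₁ y₂ : ℝ ⊗[ℚ] V) : D.hAux x (y₁ + y₂) = D.hAux x y₁ + D.hAux x y₂ := by
  apply Complex.ext <;> simp

/-- Conjugate-linearity in the first variable: `H((a + bi)x, y) = (a - bi) H(x, y)`.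
[cite: vanGeemen1994HodgeAV, Lemma 5.2 (2)] -/
theorem hAux_smul_left (z : ℂ) (x y : ℝ ⊗[ℚ] V) :
    D.hAux (z.re • x + z.im • D.I₀ x) y = conj z * D.hAux x y := by
  apply Complex.ext
  · simp only [hAux_re, map_add, map_smul, LinearMap.add_apply, LinearMap.smul_apply, smul_eq_mul,
      Eℝ_I₀, Complex.mul_re, Complex.conj_re, Complex.conj_im, hAux_im]
    ring
  · simp only [hAux_im, map_add, map_smul, LinearMap.add_apply, LinearMap.smul_apply, smul_eq_mul,
      Eℝ_I₀_left, Complex.mul_im, Complex.conj_re, Complex.conj_im, hAux_re]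
    ring

/-- `ℂ`-linearity in the second variable: `H(x, (a + bi)y) = (a + bi) H(x, y)` ("`K`-linear in the
second factor"). [cite: vanGeemen1994HodgeAV, Lemma 5.2 (2)] -/
theorem hAux_smul_right (z : ℂ) (x y : ℝ ⊗[ℚ] V) :
    D.hAux x (z.re • y + z.im • D.I₀ y) = z * D.hAux x y := by
  apply Complex.ext
  · simp only [hAux_re, map_add, map_smul, smul_eq_mul, I₀_I₀, map_neg, Complex.mul_re, hAux_im]
    ring
  · simp only [hAux_im, map_add, map_smul, smul_eq_mul, Complex.mul_im, hAux_re]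

/-- **Van Geemen's Hermitian form** `H(x, y) = E(x, iy) + iE(x, y)` on the complex vector space
`(V_ℝ, i)`, as a sesquilinear form (conjugate-linear in the first and linear in the second
variable, Mathlib's convention = van Geemen's "K-linear in the second factor").
[cite: vanGeemen1994HodgeAV, Lemma 5.2 (2) and 5.6] -/
def hForm : D.Cx →ₗ⋆[ℂ] D.Cx →ₗ[ℂ] ℂ :=
  LinearMap.mk₂'ₛₗ (starRingEnd ℂ) (RingHom.id ℂ) (fun x y => D.hAux (D.ofCx x) (D.ofCx y))
    (fun x₁ x₂ y => by rw [map_add, hAux_add_left])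
    (fun c x y => by rw [ofCx_smul, hAux_smul_left, smul_eq_mul])
    (fun x y₁ y₂ => by rw [map_add, hAux_add_right])
    (fun c x y => by rw [ofCx_smul, hAux_smul_right, RingHom.id_apply, smul_eq_mul])

/-- `H(x, y) = E_ℝ(x, I₀y) + iE_ℝ(x, y)`. [cite: vanGeemen1994HodgeAV, 5.6] -/
theorem hForm_apply (x y : D.Cx) : D.hForm x y = D.hAux (D.ofCx x) (D.ofCx y) := rfl

/-- `Re H(x, y) = E_ℝ(x, I₀y)`. [cite: vanGeemen1994HodgeAV, 5.6] -/
@[simp]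
theorem hForm_apply_re (x y : D.Cx) : (D.hForm x y).re = D.Eℝ (D.ofCx x) (D.I₀ (D.ofCx y)) := rfl

/-- **`Im H = E`** ("the polarization … will be given by the imaginary part of `H`: `E := Im H`").
[cite: vanGeemen1994HodgeAV, 5.5–5.6] -/
@[simp]
theorem hForm_apply_im (x y : D.Cx) : (D.hForm x y).im = D.Eℝ (D.ofCx x) (D.ofCx y) := rfl

/-- `Re H(x, y) = Im H(x, iy) = E_ℝ(x, iy)`. [cite: vanGeemen1994HodgeAV, 5.6] -/
theorem hForm_apply_re_eq_im (x y : D.Cx) : (D.hForm x y).re = (D.hForm x (Complex.I • y)).im := by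
  rw [hForm_apply_re, hForm_apply_im, ofCx_I_smul]

/-- **`H` is Hermitian**: `conj H(x, y) = H(y, x)` ("that `H` is Hermitian is an easy computation,
using `E((√-d)x, (√-d)y) = dE(x, y)`"). [cite: vanGeemen1994HodgeAV, Lemma 5.2 (2), proof] -/
theorem isSymm_hForm : D.hForm.IsSymm := by
  refine ⟨fun x y => Complex.ext ?_ ?_⟩
  · rw [Complex.conj_re, hForm_apply_re, hForm_apply_re, Eℝ_I₀_symm]
  · rw [Complex.conj_im, hForm_apply_im, hForm_apply_im, D.Eℝ_swap (D.ofCx y), neg_neg]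

/-- `H(x, x)` is real. [cite: vanGeemen1994HodgeAV, Lemma 5.2 (2)] -/
theorem hForm_apply_self_im (x : D.Cx) : (D.hForm x x).im = 0 := by
  rw [hForm_apply_im, Eℝ_self]

/-- `H(x, x) = E_ℝ(x, I₀ x)`. [cite: vanGeemen1994HodgeAV, proof of Lemma 5.2] -/
theorem hForm_apply_self_re (x : D.Cx) : (D.hForm x x).re = D.Eℝ (D.ofCx x) (D.I₀ (D.ofCx x)) := rfl

/-- **`H` is non-degenerate** (already `E = Im H` is). [cite: vanGeemen1994HodgeAV, Lemma 5.2 (2)] -/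
theorem separatingLeft_hForm [FiniteDimensional ℚ V] (x : D.Cx) (hx : ∀ y, D.hForm x y = 0) : x = 0 := by
  have h : ∀ y, D.Eℝ (D.ofCx x) y = 0 := fun y => by
    have := congrArg Complex.im (hx (D.toCx y))
    rwa [hForm_apply_im, Complex.zero_im] at this
  exact D.Eℝ_nondegenerate.1 (D.ofCx x) h

/-! ### Deligne's `X⁺`: complex structures of Weil type -/

/-- **Deligne's `X⁺` in the tree's vocabulary.** For an `ℝ`-linear `J : V_ℝ → V_ℝ` commuting with the
action of `K ⊗ ℝ = ℂ` (condition (a'): "`J` is `E`-linear"; here: `J` is a `ℂ`-linear endomorphism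
of `(V_ℝ, i)`), `IsWeilComplexStructure H J` (`Motives/WeilTypeComplexStructures`) says exactly:
`J² = -1`, `ψ(Jx, Jy) = ψ(x, y)` ("`ψ(x, Jy)` is symmetric iff `ψ(Jx, Jy) = ψ(x, y)`") and
`ψ(x, Jx) > 0` for `x ≠ 0` (the Riemann form `ψ = E_ℝ = Im H` is positive for `J`), i.e. `J ∈ X⁺`.
[cite: Deligne1982HodgeCycles, proof of Thm. 4.8, pp. 47–49] [cite: vanGeemen1994HodgeAV, 5.6] -/
theorem isWeilComplexStructure_iff (J : D.Cx →ₗ[ℂ] D.Cx) :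
    IsWeilComplexStructure D.hForm J ↔
      (∀ x, J (J x) = -x) ∧
        (∀ x y, D.Eℝ (D.ofCx (J x)) (D.ofCx (J y)) = D.Eℝ (D.ofCx x) (D.ofCx y)) ∧
          ∀ x, x ≠ 0 → 0 < D.Eℝ (D.ofCx x) (D.ofCx (J x)) := by
  constructor
  · rintro ⟨h1, h2, h3⟩
    exact ⟨h1, fun x y => by simpa using h2 x y, fun x hx => by simpa using h3 x hx⟩
  · rintro ⟨h1, h2, h3⟩
    exact ⟨h1, fun x y => by simpa using h2 x y, fun x hx => by simpa using h3 x hx⟩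

/-- **Unitary frames exist**: `(V_ℝ, i, H)` is a non-degenerate Hermitian space, so it has a
signature `(p, q)`, `p + q = dim_ℂ`, and an isometry with `(ℂᵖ × ℂ^q, ⟪·,·⟫ ⊖ ⟪·,·⟫)`
(`Motives/HermitianUnitaryFrame`). [cite: vanGeemen1994HodgeAV, 5.4] [cite: GohbergLancasterRodman2005, §2.3 Thm. 2.3.2] -/
theorem exists_unitaryFrame [FiniteDimensional ℚ V] :
    ∃ p q : ℕ, p + q = finrank ℂ D.Cx ∧ Nonempty (UnitaryFrame D.hForm p q) :=
  exists_unitaryFrame_of_nondegenerate D.isSymm_hForm D.separatingLeft_hForm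

/-- **`X⁺ ≠ ∅`** for every Weil datum: `(V_ℝ, i)` carries complex structures of Weil type
(positive `K`-linear complex structures compatible with `E`). [cite: Deligne1982HodgeCycles, proof of Thm. 4.8, p. 49]
[cite: vanGeemen1994HodgeAV, 5.5] -/
theorem nonempty_weilComplexStructure [FiniteDimensional ℚ V] :
    Nonempty {J : D.Cx →ₗ[ℂ] D.Cx // IsWeilComplexStructure D.hForm J} :=
  nonempty_weilComplexStructure_of_nondegenerate D.isSymm_hForm D.separatingLeft_hForm

/-- **`X⁺ ≃` a type AIII ball** for every Weil datum: for the signature `(p, q)` of `H`,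
`X⁺ ≃ {Z : ℂᵖ →L ℂ^q, ‖Z‖ < 1}`. [cite: Deligne1982HodgeCycles, proof of Thm. 4.8, p. 49]
[cite: vanGeemen1994HodgeAV, 5.8–5.10] -/
theorem exists_weilComplexStructureEquiv [FiniteDimensional ℚ V] :
    ∃ p q : ℕ, p + q = finrank ℂ D.Cx ∧
      Nonempty ({J : D.Cx →ₗ[ℂ] D.Cx // IsWeilComplexStructure D.hForm J} ≃ unitaryPeriodDomain p q) :=
  exists_weilComplexStructureEquiv_unitaryPeriodDomain D.isSymm_hForm D.separatingLeft_hForm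

end WeilDatum

/-! ### Real spans of rational subspaces -/

section RealSpan

variable {V : Type u} [AddCommGroup V] [Module ℚ V]

/-- The real span `W_ℝ = W ⊗ ℝ ⊂ V_ℝ` of a `ℚ`-subspace `W ⊂ V` (the range of `(W ↪ V) ⊗ ℝ`). [folklore] -/
def realSpan (W : Submodule ℚ V) : Submodule ℝ (ℝ ⊗[ℚ] V) :=
  LinearMap.range (W.subtype.baseChange ℝ)

/-- `a ⊗ w ∈ W_ℝ` for `w ∈ W`. [folklore] -/
theorem tmul_mem_realSpan (W : Submodule ℚ V) (a : ℝ) {w : V} (hw : w ∈ W) :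
    a ⊗ₜ[ℚ] w ∈ realSpan W :=
  ⟨a ⊗ₜ ⟨w, hw⟩, by rw [LinearMap.baseChange_tmul, Submodule.subtype_apply]⟩

/-- `dim_ℝ W_ℝ = dim_ℚ W` (`ℝ` is flat over `ℚ`). [folklore] -/
theorem finrank_realSpan [FiniteDimensional ℚ V] (W : Submodule ℚ V) :
    finrank ℝ (realSpan W) = finrank ℚ W := by
  have hinj : Function.Injective (W.subtype.baseChange ℝ) := by
    rw [← LinearMap.coe_toAddHom]
    change Function.Injective (W.subtype.baseChange ℝ : ℝ ⊗[ℚ] W → ℝ ⊗[ℚ] V)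
    rw [LinearMap.baseChange_eq_ltensor]
    exact Module.Flat.lTensor_preserves_injective_linearMap _ W.injective_subtype
  unfold realSpan
  rw [LinearMap.finrank_range_of_inj hinj, Module.finrank_baseChange]

end RealSpan

namespace WeilDatum

variable {V : Type u} [AddCommGroup V] [Module ℚ V] (D : WeilDatum V)

/-! ### The signature is `(n, n)` in the hyperbolic case -/

section Isotropic

variable {W : Submodule ℚ V}

/-- `W_ℝ` is `α_ℝ`-stable if `W` is `α`-stable. [folklore] -/
theorem αℝ_mem_realSpan (hWα : ∀ x ∈ W, D.α x ∈ W) {x : ℝ ⊗[ℚ] V} (hx : x ∈ realSpan W) :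
    D.αℝ x ∈ realSpan W := by
  obtain ⟨t, rfl⟩ := hx
  induction t using TensorProduct.induction_on with
  | zero => simp
  | tmul a w =>
    rw [LinearMap.baseChange_tmul, Submodule.subtype_apply, αℝ_tmul]
    exact tmul_mem_realSpan W a (hWα _ w.2)
  | add x y hx hy => rw [map_add, map_add]; exact add_mem hx hy

/-- `W_ℝ` is `I₀`-stable (a complex subspace of `(V_ℝ, i)`) if `W` is `α`-stable. [cite: vanGeemen1994HodgeAV, 5.5] -/
theorem I₀_mem_realSpan (hWα : ∀ x ∈ W, D.α x ∈ W) {x : ℝ ⊗[ℚ] V} (hx : x ∈ realSpan W) :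
    D.I₀ x ∈ realSpan W := by
  rw [I₀_apply]
  exact Submodule.smul_mem _ _ (D.αℝ_mem_realSpan hWα hx)

/-- `E_ℝ` vanishes on `W_ℝ × W_ℝ` if `E` vanishes on `W × W`. [folklore] -/
theorem Eℝ_realSpan (hiso : ∀ x ∈ W, ∀ y ∈ W, D.E x y = 0) {x y : ℝ ⊗[ℚ] V}
    (hx : x ∈ realSpan W) (hy : y ∈ realSpan W) : D.Eℝ x y = 0 := by
  obtain ⟨s, rfl⟩ := hx
  obtain ⟨t, rfl⟩ := hy
  induction s using TensorProduct.induction_on with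
  | zero => simp
  | tmul a w =>
    induction t using TensorProduct.induction_on with
    | zero => simp
    | tmul a' w' =>
      rw [LinearMap.baseChange_tmul, LinearMap.baseChange_tmul, Submodule.subtype_apply,
        Submodule.subtype_apply, Eℝ_tmul, hiso _ w.2 _ w'.2, Rat.cast_zero, mul_zero]
    | add x y hx hy => rw [map_add, map_add, hx, hy, add_zero]
  | add x y hx hy => rw [map_add, map_add, LinearMap.add_apply, hx, hy, add_zero]

/-- **The complex subspace `W_ℝ ⊂ (V_ℝ, i)`** spanned by an `α`-stable `ℚ`-subspace `W`.
[cite: vanGeemen1994HodgeAV, 5.5] -/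
def cxSpan (hWα : ∀ x ∈ W, D.α x ∈ W) : Submodule ℂ D.Cx where
  carrier := {x | D.ofCx x ∈ realSpan W}
  zero_mem' := (realSpan W).zero_mem
  add_mem' hx hy := (realSpan W).add_mem hx hy
  smul_mem' z x hx := by
    show D.ofCx (z • x) ∈ realSpan W
    rw [ofCx_smul]
    exact add_mem (Submodule.smul_mem _ _ hx) (Submodule.smul_mem _ _ (D.I₀_mem_realSpan hWα hx))

variable (hWα : ∀ x ∈ W, D.α x ∈ W)

/-- Membership in `cxSpan`. [folklore] -/
theorem mem_cxSpan_iff {x : D.Cx} : x ∈ D.cxSpan hWα ↔ D.ofCx x ∈ realSpan W := Iff.rfl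

/-- As a real subspace, `cxSpan` is `W_ℝ` transported along `V_ℝ ≃ (V_ℝ, i)`. [folklore] -/
theorem restrictScalars_cxSpan :
    (D.cxSpan hWα).restrictScalars ℝ = (realSpan W).map (D.toCxₗ : ℝ ⊗[ℚ] V →ₗ[ℝ] D.Cx) := by
  ext x
  rw [Submodule.restrictScalars_mem, mem_cxSpan_iff, Submodule.mem_map_equiv, toCxₗ_symm_apply]

/-- `dim_ℝ cxSpan W = dim_ℚ W`. [folklore] -/
theorem finrank_real_cxSpan [FiniteDimensional ℚ V] : finrank ℝ (D.cxSpan hWα) = finrank ℚ W := by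
  change finrank ℝ ((D.cxSpan hWα).restrictScalars ℝ) = _
  rw [restrictScalars_cxSpan, LinearEquiv.finrank_map_eq, finrank_realSpan]

/-- **`2 dim_ℂ W_ℝ = dim_ℚ W`.** [cite: vanGeemen1994HodgeAV, 5.5] -/
theorem two_mul_finrank_cxSpan [FiniteDimensional ℚ V] :
    2 * finrank ℂ (D.cxSpan hWα) = finrank ℚ W := by
  rw [← finrank_real_of_complex, finrank_real_cxSpan]

/-- **`H` vanishes on `W_ℝ`** for `W` `α`-stable and `E`-isotropic (`H(x, y) = E(x, iy) + iE(x, y)`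
and `iW_ℝ ⊆ W_ℝ`). [cite: vanGeemen1994HodgeAV, Lemma 5.2 (2) and 5.5] -/
theorem hForm_cxSpan (hiso : ∀ x ∈ W, ∀ y ∈ W, D.E x y = 0) {x y : D.Cx} (hx : x ∈ D.cxSpan hWα)
    (hy : y ∈ D.cxSpan hWα) : D.hForm x y = 0 :=
  Complex.ext
    (by rw [hForm_apply_re, Complex.zero_re]; exact D.Eℝ_realSpan hiso hx (D.I₀_mem_realSpan hWα hy))
    (by rw [hForm_apply_im, Complex.zero_im]; exact D.Eℝ_realSpan hiso hx hy)

/-- **The signature is `(n, n)`** (van Geemen Lemma 5.2 (4) in the hyperbolic normalisation of the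
tree's `IsHyperbolicWeilType`): if `dim_ℚ V = 4n` and `V` contains an `α`-stable `E`-isotropic
`ℚ`-subspace `W` of dimension `2n`, then `W_ℝ` is an `n`-dimensional totally `H`-isotropic complex
subspace, so by inertia `n ≤ p` and `n ≤ q` for the signature `(p, q)`, `p + q = 2n`, of any unitary
frame. [cite: vanGeemen1994HodgeAV, Lemma 5.2 (4) and 5.4] [cite: GohbergLancasterRodman2005, §2.3 Thm. 2.3.2] -/
theorem signature_eq_of_isotropic [FiniteDimensional ℚ V] {n : ℕ} (hV : finrank ℚ V = 4 * n)
    (hWα : ∀ x ∈ W, D.α x ∈ W) (hWn : finrank ℚ W = 2 * n) (hiso : ∀ x ∈ W, ∀ y ∈ W, D.E x y = 0)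
    {p q : ℕ} (F : UnitaryFrame D.hForm p q) : p = n ∧ q = n := by
  have hL : finrank ℂ (D.cxSpan hWα) = n := by
    have := D.two_mul_finrank_cxSpan hWα; omega
  have hCx : finrank ℂ D.Cx = 2 * n := by
    have := D.two_mul_finrank_Cx; omega
  have hpq : p + q = 2 * n := by
    rw [← hCx, F.toLinearEquiv.finrank_eq, Module.finrank_prod, finrank_euclideanSpace_fin,
      finrank_euclideanSpace_fin]
  have h0 : ∀ x ∈ D.cxSpan hWα, (D.hForm x x).re = 0 := fun x hx => by
    rw [D.hForm_cxSpan hWα hiso hx hx, Complex.zero_re]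
  have h1 := F.signatureSplitting.finrank_le_of_nonneg (W := D.cxSpan hWα) fun x hx => (h0 x hx).ge
  have h2 := F.signatureSplitting.finrank_le_of_nonpos (L := D.cxSpan hWα) fun x hx => (h0 x hx).le
  have h3 := F.signatureSplitting.finrank_pos_add_finrank_neg
  rw [F.finrank_signatureSplitting_pos] at h1 h3
  rw [hL] at h1 h2
  rw [hCx] at h3
  omega

/-- **Unitary frames of signature `(n, n)` exist** in the hyperbolic case: `(V_ℝ, i, H) ≅ (ℂⁿ × ℂⁿ,
⟪·,·⟫ ⊖ ⟪·,·⟫)` (van Geemen 5.4: "there exists a `K`-basis of `V` on which `H` is given by (5.4.1)",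
here over `ℝ`). [cite: vanGeemen1994HodgeAV, 5.4 and Lemma 5.2 (4)] -/
theorem nonempty_unitaryFrame_of_isotropic [FiniteDimensional ℚ V] {n : ℕ} (hV : finrank ℚ V = 4 * n)
    (hWα : ∀ x ∈ W, D.α x ∈ W) (hWn : finrank ℚ W = 2 * n) (hiso : ∀ x ∈ W, ∀ y ∈ W, D.E x y = 0) :
    Nonempty (UnitaryFrame D.hForm n n) := by
  obtain ⟨p, q, -, ⟨F⟩⟩ := D.exists_unitaryFrame
  obtain ⟨rfl, rfl⟩ := D.signature_eq_of_isotropic hV hWα hWn hiso F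
  exact ⟨F⟩

/-- **Deligne's `X⁺` for a hyperbolic Weil datum is the type AIII domain `SU(n, n)/S(U(n) × U(n))`**:
the positive `K`-linear `E`-compatible complex structures on `V_ℝ` are in canonical bijection (via
any unitary frame) with the open unit ball `{Z : ℂⁿ →L ℂⁿ, ‖Z‖ < 1}` (`unitaryPeriodDomain n n`, open,
convex, connected: `Motives/UnitaryPeriodDomain`). [cite: Deligne1982HodgeCycles, proof of Thm. 4.8, p. 49]
[cite: vanGeemen1994HodgeAV, 5.8–5.10] [cite: CarlsonMullerStachPeters2017, Thm. 16.1.5 (type AIII)] -/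
theorem nonempty_weilComplexStructureEquiv_of_isotropic [FiniteDimensional ℚ V] {n : ℕ}
    (hV : finrank ℚ V = 4 * n) (hWα : ∀ x ∈ W, D.α x ∈ W) (hWn : finrank ℚ W = 2 * n)
    (hiso : ∀ x ∈ W, ∀ y ∈ W, D.E x y = 0) :
    Nonempty ({J : D.Cx →ₗ[ℂ] D.Cx // IsWeilComplexStructure D.hForm J} ≃ unitaryPeriodDomain n n) := by
  obtain ⟨F⟩ := D.nonempty_unitaryFrame_of_isotropic hV hWα hWn hiso
  exact ⟨F.weilComplexStructureEquiv⟩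

/-- **van Geemen 5.5/5.8 for the datum**: in the hyperbolic case the polarizing planes `V₊ ⊂ (V_ℝ, i)`
("`dim_ℂ V₊ = n` such that `H|_{V₊} > 0`", which determine the complex structures `J_{V₊}`) are
exactly the positive definite complex subspaces of dimension `n`. [cite: vanGeemen1994HodgeAV, 5.5 and 5.8] -/
theorem isPolarizingPlane_iff_of_isotropic [FiniteDimensional ℚ V] {n : ℕ} (hV : finrank ℚ V = 4 * n)
    (hWα : ∀ x ∈ W, D.α x ∈ W) (hWn : finrank ℚ W = 2 * n) (hiso : ∀ x ∈ W, ∀ y ∈ W, D.E x y = 0)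
    {M : Submodule ℂ D.Cx} :
    IsPolarizingPlane D.hForm M ↔ IsPosDefOn D.hForm M ∧ finrank ℂ M = n := by
  obtain ⟨F⟩ := D.nonempty_unitaryFrame_of_isotropic hV hWα hWn hiso
  exact F.isPolarizingPlane_iff

end Isotropic

end WeilDatum

end Literature.AlgebraicGeometry.Motives

end
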